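import Summits.Ventures.HodgeKum4.Theorems.KummerFixedLocusAndreDischarged
import Literature.AlgebraicGeometry.HodgeTheory.HodgeIndexTheoremSigned
import HarnessLib

/-!
# Route `KummerFixedLocus`: the Hodge-index input DISCHARGED and `|Γ| = 625` folded into `Γ ≅ (ℤ/5)⁴` — the closers of record with two binders fewer (cell `hodge-kum4`, seat p2 g9)

HONEST FRAMING.  Nothing here proves L1, I1geo, `HC_Kum4Type` or the Hodge conjecture outright.  Every theorem is
CONDITIONAL on the printed statements it names — named Literature facts taken as hypotheses — and, where stated,
on p1's cell lemma L1 (`LefschetzGenerationKum4`).  What changes with this file, and nothing else: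

* the REFEREED input `HodgeTheory.Voisin2002_hodgeIndex_hodgeRiemann_middle` (Voisin I Thm. 6.33, the Hodge index
  theorem `sign Q = Σ (-1)^a h^{a,b}` on `H^{2m}(X, ℝ)`, and Thm. 6.32 in the middle degree, orientation-free form —
  the binder `hHIR` of every landed closer of the route) is a THEOREM of the tree:
  `HodgeTheory.Voisin2002_hodgeIndex_hodgeRiemann_middle_holds`
  (`Literature/AlgebraicGeometry/HodgeTheory/HodgeIndexTheoremSigned`, family `hodge`: Lefschetz blocks, Voisin's
  Lemma 6.31 orthogonality, the sign `(-1)^s` from Thm. 6.32, real forms and Sylvester's law) — so each closer is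
  restated with that binder SUPPLIED BY THE THEOREM;
* the REFEREED input `Hyperkaehler.Floccari2026_card_autFixingH2H3_kum4Type` (`|Γ(X)| = 625`, binder `hcardF`) is
  supplied from the binder `hFV : Hyperkaehler.FloccariVaresco2024_autFixingH2H3_equiv_kumType` (`Γ(X) ≅ (ℤ/5)⁴`,
  Boissière–Nieper-Wißkirchen–Sarti ⊕ Hassett–Tschinkel as stated by Floccari–Varesco) through the tree lemma
  `FloccariVaresco2024_autFixingH2H3_equiv_kumType.floccari2026_card` (`5⁴ = 625`, PROVED in
  `Hyperkaehler/GeneralizedKummerTypeTranslationGroup`).  Honest nuance: for a statement whose only use of `Γ` is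
  its order this is a trade UP to the stronger refereed statement, not a discharge; in the bills below `hFV` is
  load-bearing anyway (it feeds I1geo through `kum4FixedFourfoldMeetsTranslates_of_split125`, resp. the
  Kummer-point chain), so the number of DISTINCT named print inputs genuinely drops.

One-line applications of the landed closers; no new mathematics on this side; no new named fact; outside the
route file's import cone.

WHAT IS PROVED (all CONDITIONAL on the remaining named facts):
* `kum4FixedFourfoldClasses_of_L1_of_split125` — crux I `Kum4FixedFourfoldClasses` from NINE named facts
  (EIGHT REFEREED: Hirzebruch `g`-signature, Floccari's fixed fourfold, Göttsche–Soergel `χ_y`, GKLR LLV-trivial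
  classes, Foster's translation action, Fulton's transversal pairing, `Γ ≅ (ℤ/5)⁴`, the tangent-dimension fact;
  ONE PRINT-SYNTHESIS: F125X) + L1.
* `kum4NonInvariantClassesAlgebraic_of_L1_of_split125` — L3° `Kum4NonInvariantClassesAlgebraic` (the statement
  of route item stmt-Ventures-19135, by name) from the same NINE named facts + L1.
* `hc_kum4Type_of_L1_of_meetsTranslates''` — the item-level shape: `HC_Kum4Type ∧ HC_Kum4TypePowers` from TEN
  REFEREED named facts + L1 + the geometric residual I1geo (was twelve facts, `hc_kum4Type_of_L1_of_meetsTranslates`;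
  here `|Γ| = 625` stays a binder — without I1geo's inputs nothing stronger is on the list to fold it into).
* `hc_kum4Type_of_L1_of_split125''` — **bill A‴ of record with THIRTEEN binders** = TWELVE named Literature facts
  (ELEVEN REFEREED: O'Grady–Voisin, Floccari–Fu, Foster `B`, Hirzebruch `g`-signature, Floccari's fixed
  fourfold, Göttsche–Soergel `χ_y`, GKLR LLV-trivial classes, Foster's translation action, Fulton's transversal
  pairing, `Γ ≅ (ℤ/5)⁴`, the tangent-dimension fact; ONE PRINT-SYNTHESIS: F125X) + L1
  ⇒ `HC_Kum4Type ∧ HC_Kum4TypePowers` (was fifteen binders, `hc_kum4Type_of_L1_of_split125'`, p468390).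
* `hc_kum4Type_of_L1_of_tangentFixed'''` — the alternative bill A′ with FOURTEEN binders (was sixteen,
  `hc_kum4Type_of_L1_of_tangentFixed''`).
* The L2a′/L2 restatements of `KummerFixedLocusAndreDischarged` are not repeated: they use neither input.
Rung currency (the cell's words are the director's, not this file's): the count of named print inputs of the
by-name closer of record drops from 14 (13 REFEREED + F125X) to 12 (11 REFEREED + F125X) + L1; open mathematics
unchanged (`{MODEL_X computed clause (19267)}`).
-/

noncomputable section

open CategoryTheory CategoryTheory.Limits MonoidalCategory
open Literature.AlgebraicGeometry Literature.AlgebraicGeometry.Motives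
open Literature.AlgebraicGeometry.Hyperkaehler Literature.AlgebraicGeometry.GroupActions
open Literature.AlgebraicGeometry.HodgeTheory

namespace Summit.Ventures.HodgeKum4

/-- **Crux I `Kum4FixedFourfoldClasses` from NINE named facts + L1** — `kum4FixedFourfoldClasses_of_L1_of_meetsTranslates`
with its Hodge-index binder supplied by the tree theorem `Voisin2002_hodgeIndex_hodgeRiemann_middle_holds`, its André
binder by `Andre1996_dualLefschetz_mem_adjoin_lefschetzInvolution_holds`, `|Γ| = 625` by `hFV.floccari2026_card`, and
the geometric residual I1geo by `kum4FixedFourfoldMeetsTranslates_of_split125 hFV hTan h125`.  EIGHT REFEREED facts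
(Hirzebruch `g`-signature, Floccari's fixed fourfold, Göttsche–Soergel, GKLR, Foster's translation action, Fulton,
`Γ ≅ (ℤ/5)⁴`, the tangent-dimension fact), ONE PRINT-SYNTHESIS fact (F125X) and L1.  CONDITIONAL on all ten;
nothing is proved outright. -/
theorem kum4FixedFourfoldClasses_of_L1_of_split125
    (hA1 : Hirzebruch1969_gSignature_involution_halfDimFixedLocus)
    (hA2 : Floccari2026_fixedFourfold_kum4Type)
    (hGS : GoettscheSoergel1993_chiY_kum4Type)
    (hGK : GreenKimLazaRobles2022_llvTrivial_isOfHodgeType_kumType)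
    (hF : Foster2024_translationAction_kum4Type)
    (hFu : Fulton1998_cupPairing_transversalPoint)
    (hFV : FloccariVaresco2024_autFixingH2H3_equiv_kumType)
    (hTan : GroupActions.Milne2017_fixedComponent_dim_eq_finrank_tangentFixed)
    (h125 : HassettTschinkel2013_Oguiso2020_fixedPointScheme_translation_kum4Type)
    (hL1 : LefschetzGenerationKum4) :
    Summit.Ventures.HodgeKum4.Kum4FixedFourfoldClasses :=
  kum4FixedFourfoldClasses_of_L1_of_meetsTranslates hA1 hA2 Voisin2002_hodgeIndex_hodgeRiemann_middle_holds hGS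
    hGK hF hFV.floccari2026_card hFu Andre1996_dualLefschetz_mem_adjoin_lefschetzInvolution_holds hL1
    (kum4FixedFourfoldMeetsTranslates_of_split125 hFV hTan h125)

/-- **L3° `Kum4NonInvariantClassesAlgebraic` — the statement of route item stmt-Ventures-19135, by name — from
NINE named facts + L1**: `kum4NonInvariantClassesAlgebraic_of_L1_of_meetsTranslates` with the Hodge-index binder
supplied by `Voisin2002_hodgeIndex_hodgeRiemann_middle_holds`, the André binder by
`Andre1996_dualLefschetz_mem_adjoin_lefschetzInvolution_holds`, `|Γ| = 625` by `hFV.floccari2026_card` and I1geo by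
`kum4FixedFourfoldMeetsTranslates_of_split125`.  EIGHT REFEREED facts, F125X (PRINT-SYNTHESIS) and L1.
CONDITIONAL on all ten; this does not close the item (its own signature is not proved outright). -/
theorem kum4NonInvariantClassesAlgebraic_of_L1_of_split125
    (hA1 : Hirzebruch1969_gSignature_involution_halfDimFixedLocus)
    (hA2 : Floccari2026_fixedFourfold_kum4Type)
    (hGS : GoettscheSoergel1993_chiY_kum4Type)
    (hGK : GreenKimLazaRobles2022_llvTrivial_isOfHodgeType_kumType)
    (hF : Foster2024_translationAction_kum4Type)
    (hFu : Fulton1998_cupPairing_transversalPoint)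
    (hFV : FloccariVaresco2024_autFixingH2H3_equiv_kumType)
    (hTan : GroupActions.Milne2017_fixedComponent_dim_eq_finrank_tangentFixed)
    (h125 : HassettTschinkel2013_Oguiso2020_fixedPointScheme_translation_kum4Type)
    (hL1 : LefschetzGenerationKum4) :
    Summit.Ventures.HodgeKum4.Kum4NonInvariantClassesAlgebraic :=
  kum4NonInvariantClassesAlgebraic_of_L1_of_meetsTranslates hA1 hA2 Voisin2002_hodgeIndex_hodgeRiemann_middle_holds
    hGS hGK hF hFV.floccari2026_card hFu Andre1996_dualLefschetz_mem_adjoin_lefschetzInvolution_holds hL1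
    (kum4FixedFourfoldMeetsTranslates_of_split125 hFV hTan h125)

/-- **H3 modulo L1, I1geo and TEN REFEREED facts** (the item-level shape of `hc_kum4Type_of_L1_of_meetsTranslates`,
p-landed with twelve facts): the Hodge-index binder is supplied by the tree theorem
`Voisin2002_hodgeIndex_hodgeRiemann_middle_holds` and the André binder by
`Andre1996_dualLefschetz_mem_adjoin_lefschetzInvolution_holds`; `|Γ| = 625` stays a binder here.  CONDITIONAL on the
ten facts, L1 and the geometric residual `Kum4FixedFourfoldMeetsTranslates`; nothing is proved outright. -/
theorem hc_kum4Type_of_L1_of_meetsTranslates''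
    (hOGV : OGradyVoisin2022_thirdJacobian_kugaSatake_kummerType)
    (hFF : FloccariFu2026_hodgeClasses_algebraic_powers_discOneWeilFourfold)
    (hFo : Foster2024_lefschetzStandard_kummerType_prime)
    (hA1 : Hirzebruch1969_gSignature_involution_halfDimFixedLocus)
    (hA2 : Floccari2026_fixedFourfold_kum4Type)
    (hGS : GoettscheSoergel1993_chiY_kum4Type)
    (hGK : GreenKimLazaRobles2022_llvTrivial_isOfHodgeType_kumType)
    (hF : Foster2024_translationAction_kum4Type)
    (hcardF : Floccari2026_card_autFixingH2H3_kum4Type)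
    (hFu : Fulton1998_cupPairing_transversalPoint)
    (hL1 : LefschetzGenerationKum4) (hgeo : Kum4FixedFourfoldMeetsTranslates) :
    Summit.Ventures.HodgeKum4.HC_Kum4Type ∧ Summit.Ventures.HodgeKum4.HC_Kum4TypePowers :=
  hc_kum4Type_of_L1_of_meetsTranslates hOGV hFF hFo Andre1996_dualLefschetz_mem_adjoin_lefschetzInvolution_holds hA1
    hA2 Voisin2002_hodgeIndex_hodgeRiemann_middle_holds hGS hGK hF hcardF hFu hL1 hgeo

/-- **Bill A‴ of record with THIRTEEN binders: H3 for `Kum⁴`-type and its powers from TWELVE NAMED FACTS + L1** —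
ELEVEN REFEREED named facts (O'Grady–Voisin `KS ~ J³`, Floccari–Fu, Foster `B(X)`, Hirzebruch `g`-signature,
Floccari's fixed fourfold, Göttsche–Soergel `χ_y`, GKLR LLV-trivial classes, Foster's translation action, Fulton's
transversal pairing, `Γ ≅ (ℤ/5)⁴`, the tangent-dimension fact), ONE PRINT-SYNTHESIS named fact (F125X:
`HassettTschinkel2013_Oguiso2020_fixedPointScheme_translation_kum4Type`) and p1's cell lemma L1
`LefschetzGenerationKum4`: `hc_kum4Type_of_L1_of_split125` (p451323) with its André binder supplied by
`Andre1996_dualLefschetz_mem_adjoin_lefschetzInvolution_holds`, its Hodge-index binder by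
`Voisin2002_hodgeIndex_hodgeRiemann_middle_holds` and `|Γ| = 625` by `hFV.floccari2026_card`.  NO transport (T), NO
Kummer-point input, NO (H2).  CONDITIONAL on all thirteen; nothing here says `HC_Kum4Type` or the Hodge conjecture is
proved outright. -/
theorem hc_kum4Type_of_L1_of_split125''
    (hOGV : OGradyVoisin2022_thirdJacobian_kugaSatake_kummerType)
    (hFF : FloccariFu2026_hodgeClasses_algebraic_powers_discOneWeilFourfold)
    (hFo : Foster2024_lefschetzStandard_kummerType_prime)
    (hA1 : Hirzebruch1969_gSignature_involution_halfDimFixedLocus)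
    (hA2 : Floccari2026_fixedFourfold_kum4Type)
    (hGS : GoettscheSoergel1993_chiY_kum4Type)
    (hGK : GreenKimLazaRobles2022_llvTrivial_isOfHodgeType_kumType)
    (hF : Foster2024_translationAction_kum4Type)
    (hFu : Fulton1998_cupPairing_transversalPoint)
    (hFV : FloccariVaresco2024_autFixingH2H3_equiv_kumType)
    (hTan : GroupActions.Milne2017_fixedComponent_dim_eq_finrank_tangentFixed)
    (h125 : HassettTschinkel2013_Oguiso2020_fixedPointScheme_translation_kum4Type)
    (hL1 : LefschetzGenerationKum4) :
    Summit.Ventures.HodgeKum4.HC_Kum4Type ∧ Summit.Ventures.HodgeKum4.HC_Kum4TypePowers :=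
  hc_kum4Type_of_L1_of_split125 hOGV hFF hFo Andre1996_dualLefschetz_mem_adjoin_lefschetzInvolution_holds hA1 hA2
    Voisin2002_hodgeIndex_hodgeRiemann_middle_holds hGS hGK hF hFV.floccari2026_card hFu hFV hTan h125 hL1

/-- **Bill A′ with FOURTEEN binders: H3 for `Kum⁴`-type and its powers from REFEREED PRINT + the transport synthesis
(T) + L1** — `hc_kum4Type_of_L1_of_tangentFixed'` (p442732) with its André binder supplied by
`Andre1996_dualLefschetz_mem_adjoin_lefschetzInvolution_holds`, its Hodge-index binder by
`Voisin2002_hodgeIndex_hodgeRiemann_middle_holds` and `|Γ| = 625` by `hFV.floccari2026_card`: thirteen printed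
statements (twelve refereed — O'Grady–Voisin, Floccari–Fu, Foster `B`, Hirzebruch, Floccari's fixed fourfold,
Göttsche–Soergel, GKLR, Foster's translation action, Fulton, `Γ ≅ (ℤ/5)⁴`, Oguiso's split fixed points, the
tangent-dimension fact; one print-synthesis: the cohomological transport (T)) and L1.  CONDITIONAL on all
fourteen; nothing here says `HC_Kum4Type` or the Hodge conjecture is proved outright. -/
theorem hc_kum4Type_of_L1_of_tangentFixed'''
    (hOGV : OGradyVoisin2022_thirdJacobian_kugaSatake_kummerType)
    (hFF : FloccariFu2026_hodgeClasses_algebraic_powers_discOneWeilFourfold)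
    (hFo : Foster2024_lefschetzStandard_kummerType_prime)
    (hA1 : Hirzebruch1969_gSignature_involution_halfDimFixedLocus)
    (hA2 : Floccari2026_fixedFourfold_kum4Type)
    (hGS : GoettscheSoergel1993_chiY_kum4Type)
    (hGK : GreenKimLazaRobles2022_llvTrivial_isOfHodgeType_kumType)
    (hF : Foster2024_translationAction_kum4Type)
    (hFu : Fulton1998_cupPairing_transversalPoint)
    (hFV : FloccariVaresco2024_autFixingH2H3_equiv_kumType)
    (hTr : HassettTschinkel2013_Floccari2026_fixedFourfoldClass_transport_kum4Type)
    (hOg : Oguiso2020_fixedPointScheme_translation_generalizedKummerFour)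
    (hTan : GroupActions.Milne2017_fixedComponent_dim_eq_finrank_tangentFixed)
    (hL1 : LefschetzGenerationKum4) :
    Summit.Ventures.HodgeKum4.HC_Kum4Type ∧ Summit.Ventures.HodgeKum4.HC_Kum4TypePowers :=
  hc_kum4Type_of_L1_of_tangentFixed' hOGV hFF hFo Andre1996_dualLefschetz_mem_adjoin_lefschetzInvolution_holds hA1
    hA2 Voisin2002_hodgeIndex_hodgeRiemann_middle_holds hGS hGK hF hFV.floccari2026_card hFu hFV hTr hOg hTan hL1

end Summit.Ventures.HodgeKum4

end
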